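import Mathlib.Analysis.ODE.ExistUnique
import Mathlib.Analysis.Calculus.ContDiff.RCLike
import Mathlib.Analysis.Calculus.Deriv.Shift
import Mathlib.Algebra.Order.Floor.Defs
import HarnessLib

/-!
# Buckmaster–Cao-Labora–Gómez-Serrano: continuation of solutions of autonomous `C¹` systems

Topic `Literature/Analysis/FluidPDE`; namespace
`Literature.Analysis.FluidPDE.BuckmasterCaolaboraGomezserrano2025.ODE`. Companion of
`CompressibleEulerImplosion.lean` (named fact `BuckmasterCaolaboraGomezserrano2025_thm11_monatomic`,
THEOREM 1.1 of T. Buckmaster, G. Cao-Labora, J. Gómez-Serrano, *Smooth imploding solutions for 3D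
compressible fluids*, Forum Math. Pi 13 (2025) e6, arXiv:2208.09445).

Brick A-ext of the discharge plan: the standard ODE theory behind Proposition 1.6 ("We first
begin with a result for the maximal time of existence of solutions to the ODE (1.8)") and behind
every barrier argument of §§3–6 ("the solution cannot exit the region `𝒯` … therefore, as `𝒯` is
bounded, …"), for an autonomous vector field `F` which is `C¹` at the points of a set `U` of a
complete normed space:

* `eqOn_of_contDiffAt` — uniqueness on an open interval (local Lipschitz from `C¹`,
  `ODE_solution_unique_of_eventually`, connectedness);
* `exists_uniform_time` — on a compact `K ⊆ U` the time of existence is uniform;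
* `exists_extend` — a solution on `(a, T)` passing through a point of `K` at a time `t₁` extends
  to `(a, t₁ + ε)`;
* `exists_forall_hasDerivAt_of_confined` — **global forward existence under confinement**: if
  every solution issued from `x₀` at time `t₀` stays in the compact `K ⊆ U` as long as it exists,
  then the solution exists for all `t ≥ t₀`.

Mathlib supplies local existence (`ContDiffAt.exists_forall_mem_closedBall_exists_eq_forall_mem_Ioo_hasDerivAt`)
and local uniqueness; the continuation statements are not in Mathlib. Theorems only, all
folklore. [cite: BuckmasterCaolaboraGomezserrano2025, Prop. 1.6, §9.1]
-/

noncomputable section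

open Set Filter Metric Topology

namespace Literature.Analysis.FluidPDE

namespace BuckmasterCaolaboraGomezserrano2025

namespace ODE

variable {E : Type*} [NormedAddCommGroup E] [NormedSpace ℝ E] {F : E → E} {U : Set E}

/-! ### Uniqueness -/

/-- **Local uniqueness** for an autonomous field `C¹` at the common value. [folklore] -/
theorem eventuallyEq_of_contDiffAt {c₁ c₂ : ℝ → E} {t₀ : ℝ}
    (hF : ContDiffAt ℝ 1 F (c₁ t₀))
    (h₁ : ∀ᶠ t in 𝓝 t₀, HasDerivAt c₁ (F (c₁ t)) t)
    (h₂ : ∀ᶠ t in 𝓝 t₀, HasDerivAt c₂ (F (c₂ t)) t) (heq : c₁ t₀ = c₂ t₀) :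
    c₁ =ᶠ[𝓝 t₀] c₂ := by
  obtain ⟨K, S, hS, hK⟩ := hF.exists_lipschitzOnWith
  have hc₁ : ContinuousAt c₁ t₀ := (h₁.self_of_nhds).continuousAt
  have hc₂ : ContinuousAt c₂ t₀ := (h₂.self_of_nhds).continuousAt
  have hm₁ : ∀ᶠ t in 𝓝 t₀, c₁ t ∈ S := hc₁.preimage_mem_nhds hS
  have hm₂ : ∀ᶠ t in 𝓝 t₀, c₂ t ∈ S := hc₂.preimage_mem_nhds (by rw [← heq]; exact hS)
  exact ODE_solution_unique_of_eventually (v := fun _ => F) (s := fun _ => S)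
    (Eventually.of_forall fun _ => hK) (h₁.and hm₁) (h₂.and hm₂) heq

/-- **Uniqueness on an open interval**: two solutions on `(a, b)`, the first with values where
`F` is `C¹`, agreeing at `t₀ ∈ (a, b)`, agree on `(a, b)`. [folklore] -/
theorem eqOn_of_contDiffAt {c₁ c₂ : ℝ → E} {a b t₀ : ℝ} (ht₀ : t₀ ∈ Ioo a b)
    (hF : ∀ t ∈ Ioo a b, ContDiffAt ℝ 1 F (c₁ t))
    (h₁ : ∀ t ∈ Ioo a b, HasDerivAt c₁ (F (c₁ t)) t)
    (h₂ : ∀ t ∈ Ioo a b, HasDerivAt c₂ (F (c₂ t)) t)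
    (heq : c₁ t₀ = c₂ t₀) : EqOn c₁ c₂ (Ioo a b) := by
  set u : Set ℝ := {t | t ∈ Ioo a b ∧ c₁ =ᶠ[𝓝 t] c₂} with hu
  have hev : ∀ t ∈ Ioo a b, ∀ᶠ s in 𝓝 t, s ∈ Ioo a b := fun t ht => isOpen_Ioo.mem_nhds ht
  have hd₁ : ∀ t ∈ Ioo a b, ∀ᶠ s in 𝓝 t, HasDerivAt c₁ (F (c₁ s)) s :=
    fun t ht => (hev t ht).mono fun s hs => h₁ s hs
  have hd₂ : ∀ t ∈ Ioo a b, ∀ᶠ s in 𝓝 t, HasDerivAt c₂ (F (c₂ s)) s :=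
    fun t ht => (hev t ht).mono fun s hs => h₂ s hs
  have hu_open : IsOpen u := by
    rw [isOpen_iff_mem_nhds]
    rintro t ⟨ht, hte⟩
    have : ∀ᶠ s in 𝓝 t, c₁ =ᶠ[𝓝 s] c₂ := hte.eventually_nhds
    exact ((hev t ht).and this).mono fun s hs => hs
  have ht₀u : t₀ ∈ u :=
    ⟨ht₀, eventuallyEq_of_contDiffAt (hF t₀ ht₀) (hd₁ t₀ ht₀) (hd₂ t₀ ht₀) heq⟩
  have hcl : closure u ∩ Ioo a b ⊆ u := by
    rintro t ⟨htc, ht⟩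
    have hc₁ : ContinuousAt c₁ t := (h₁ t ht).continuousAt
    have hc₂ : ContinuousAt c₂ t := (h₂ t ht).continuousAt
    have hEq : c₁ t = c₂ t := by
      have hmem : t ∈ closure {s | c₁ s = c₂ s} :=
        closure_mono (fun s hs => (hs.2 : c₁ =ᶠ[𝓝 s] c₂).eq_of_nhds) htc
      by_contra hne
      have hopen : IsOpen {p : E × E | p.1 ≠ p.2} := isOpen_ne_fun continuous_fst continuous_snd
      have : ∀ᶠ s in 𝓝 t, c₁ s ≠ c₂ s :=
        (hc₁.prodMk hc₂).preimage_mem_nhds (hopen.mem_nhds hne)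
      obtain ⟨V, hV, hVsub⟩ := eventually_iff_exists_mem.mp this
      obtain ⟨s, hsV, hs⟩ := mem_closure_iff_nhds.mp hmem V hV
      exact hVsub s hsV hs
    exact ⟨ht, eventuallyEq_of_contDiffAt (hF t ht) (hd₁ t ht) (hd₂ t ht) hEq⟩
  have hsub : Ioo a b ⊆ u :=
    isPreconnected_Ioo.subset_of_closure_inter_subset hu_open ⟨t₀, ht₀, ht₀u⟩ hcl
  intro t ht
  exact ((hsub ht).2 : c₁ =ᶠ[𝓝 t] c₂).eq_of_nhds

/-! ### Uniform time of existence on compact sets -/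

/-- Time translation of a solution of an autonomous equation. [folklore] -/
theorem hasDerivAt_comp_sub {α : ℝ → E} {ε t₀ : ℝ}
    (hα : ∀ t ∈ Ioo (-ε) ε, HasDerivAt α (F (α t)) t) :
    ∀ t ∈ Ioo (t₀ - ε) (t₀ + ε), HasDerivAt (fun s => α (s - t₀)) (F (α (t - t₀))) t := by
  intro t ht
  have h := hα (t - t₀) ⟨by linarith [ht.1], by linarith [ht.2]⟩
  exact h.comp_sub_const t t₀

/-- **Uniform existence time on a compact set.** If `F` is `C¹` at every point of `U` and
`K ⊆ U` is compact, there is `ε > 0` such that through every point of `K`, at every initial time,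
passes a solution defined for time `ε` in both directions. [folklore] -/
theorem exists_uniform_time [CompleteSpace E] (hF : ∀ x ∈ U, ContDiffAt ℝ 1 F x) {K : Set E}
    (hK : IsCompact K) (hKU : K ⊆ U) :
    ∃ ε > (0 : ℝ), ∀ x ∈ K, ∀ t₀ : ℝ, ∃ α : ℝ → E, α t₀ = x ∧
      ∀ t ∈ Ioo (t₀ - ε) (t₀ + ε), HasDerivAt α (F (α t)) t := by
  have h : ∀ x ∈ K, ∃ r > (0 : ℝ), ∃ ε > (0 : ℝ), ∀ y ∈ closedBall x r, ∃ α : ℝ → E, α 0 = y ∧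
      ∀ t ∈ Ioo (0 - ε) (0 + ε), HasDerivAt α (F (α t)) t := fun x hx =>
    (hF x (hKU hx)).exists_forall_mem_closedBall_exists_eq_forall_mem_Ioo_hasDerivAt 0
  choose! r hr ε hε H using h
  obtain ⟨t, htK, hcover⟩ := hK.elim_nhds_subcover (fun x => ball x (r x))
    (fun x hx => ball_mem_nhds x (hr x hx))
  rcases t.eq_empty_or_nonempty with rfl | hne
  · -- `K` is empty
    refine ⟨1, one_pos, fun x hx => ?_⟩
    have : x ∈ (∅ : Set E) := by simpa using hcover hx
    exact this.elim
  · refine ⟨t.inf' hne ε, ?_, fun x hx t₀ => ?_⟩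
    · exact (Finset.lt_inf'_iff hne).mpr fun i hi => hε i (htK i hi)
    · obtain ⟨i, hi, hxi⟩ : ∃ i ∈ t, x ∈ ball i (r i) := by
        have := hcover hx
        simpa only [mem_iUnion, exists_prop] using this
      obtain ⟨α, hα0, hα⟩ := H i (htK i hi) x (ball_subset_closedBall hxi)
      refine ⟨fun s => α (s - t₀), by simp [hα0], ?_⟩
      have hle : t.inf' hne ε ≤ ε i := Finset.inf'_le ε hi
      intro s hs
      have hα' : ∀ t ∈ Ioo (-ε i) (ε i), HasDerivAt α (F (α t)) t := fun t ht =>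
        hα t ⟨by linarith [ht.1], by linarith [ht.2]⟩
      exact hasDerivAt_comp_sub hα' s ⟨by linarith [hs.1], by linarith [hs.2]⟩

/-! ### Extension of a solution through a point of `K` -/

/-- Gluing two solutions which agree at `t₁`: `c` on the left, `α` on the right. [folklore] -/
theorem hasDerivAt_glue {c α : ℝ → E} {t₁ : ℝ} (hc : HasDerivAt c (F (c t₁)) t₁)
    (hα : HasDerivAt α (F (α t₁)) t₁) (h0 : α t₁ = c t₁) :
    HasDerivAt (fun t => if t ≤ t₁ then c t else α t) (F (c t₁)) t₁ := by
  set g : ℝ → E := fun t => if t ≤ t₁ then c t else α t with hg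
  have hgt₁ : g t₁ = c t₁ := by simp only [hg, if_pos le_rfl]
  have hl : HasDerivWithinAt g (F (c t₁)) (Iic t₁) t₁ :=
    hc.hasDerivWithinAt.congr (fun x hx => by simp only [hg, if_pos (mem_Iic.mp hx)]) hgt₁
  have hα' : HasDerivAt α (F (c t₁)) t₁ := by rw [h0] at hα; exact hα
  have hr : HasDerivWithinAt g (F (c t₁)) (Ici t₁) t₁ := by
    refine hα'.hasDerivWithinAt.congr (fun x hx => ?_) (hgt₁.trans h0.symm)
    rcases eq_or_lt_of_le (mem_Ici.mp hx) with h | h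
    · subst h; exact hgt₁.trans h0.symm
    · simp only [hg, if_neg (not_le.mpr h)]
  have := hl.union hr
  rwa [Iic_union_Ici, hasDerivWithinAt_univ] at this

/-- **Extension step.** Let `ε` be a uniform existence time on `K` (as provided by
`exists_uniform_time`). A solution `c` on `(a, T)`, along which `F` is `C¹` on `(a', T)`, with
`c t₁ ∈ K` for some `t₁ ∈ (a', T)`, `T ≤ t₁ + ε`, agrees on `(a, T)` with a solution defined on
`(a, t₁ + ε)`. [folklore] -/
theorem exists_extend {K : Set E} {ε : ℝ}
    (hε : ∀ x ∈ K, ∀ t₀ : ℝ, ∃ α : ℝ → E, α t₀ = x ∧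
      ∀ t ∈ Ioo (t₀ - ε) (t₀ + ε), HasDerivAt α (F (α t)) t)
    {c : ℝ → E} {a a' T t₁ : ℝ} (haa' : a ≤ a') (ht₁ : t₁ ∈ Ioo a' T) (hT : T ≤ t₁ + ε)
    (hc : ∀ t ∈ Ioo a T, HasDerivAt c (F (c t)) t)
    (hcU : ∀ t ∈ Ioo a' T, ContDiffAt ℝ 1 F (c t)) (hK : c t₁ ∈ K) :
    ∃ c' : ℝ → E, EqOn c' c (Ioo a T) ∧ ∀ t ∈ Ioo a (t₁ + ε), HasDerivAt c' (F (c' t)) t := by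
  obtain ⟨α, hα0, hα⟩ := hε (c t₁) hK t₁
  have hεpos : 0 < ε := by linarith [ht₁.2]
  -- `α = c` on `I = (max a' (t₁ - ε), T)` by uniqueness
  set I : Set ℝ := Ioo (max a' (t₁ - ε)) T with hI
  have ht₁I : t₁ ∈ I := ⟨max_lt ht₁.1 (by linarith), ht₁.2⟩
  have hIsub : I ⊆ Ioo a' T := fun t ht => ⟨(le_max_left _ _).trans_lt ht.1, ht.2⟩
  have hIsub' : I ⊆ Ioo (t₁ - ε) (t₁ + ε) := fun t ht =>
    ⟨(le_max_right _ _).trans_lt ht.1, lt_of_lt_of_le ht.2 hT⟩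
  have huniq : EqOn c α I :=
    eqOn_of_contDiffAt ht₁I (fun t ht => hcU t (hIsub ht))
      (fun t ht => hc t ⟨lt_of_le_of_lt haa' (hIsub ht).1, ht.2⟩) (fun t ht => hα t (hIsub' ht))
      hα0.symm
  set g : ℝ → E := fun t => if t ≤ t₁ then c t else α t with hg
  refine ⟨g, fun t ht => ?_, fun t ht => ?_⟩
  · -- agreement on `(a, T)`
    by_cases h : t ≤ t₁
    · simp only [hg, if_pos h]
    · simp only [hg, if_neg h]
      exact (huniq ⟨max_lt (ht₁.1.trans (not_le.mp h)) (by linarith [not_le.mp h]), ht.2⟩).symm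
  · -- `g` solves on `(a, t₁ + ε)`
    rcases lt_trichotomy t t₁ with hlt | rfl | hgt
    · have hev : g =ᶠ[𝓝 t] c := by
        filter_upwards [Iio_mem_nhds hlt] with s hs
        simp only [hg, if_pos (mem_Iio.mp hs).le]
      have hgt : g t = c t := by simp only [hg, if_pos hlt.le]
      rw [hgt]
      exact (hc t ⟨ht.1, hlt.trans ht₁.2⟩).congr_of_eventuallyEq hev
    · have h := hasDerivAt_glue (hc t ⟨lt_of_le_of_lt haa' ht₁.1, ht₁.2⟩)
        (hα t ⟨by linarith, by linarith⟩) hα0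
      have hgt : g t = c t := by simp only [hg, if_pos le_rfl]
      rw [hgt]
      exact h
    · have hev : g =ᶠ[𝓝 t] α := by
        filter_upwards [Ioi_mem_nhds hgt] with s hs
        simp only [hg, if_neg (not_le.mpr (mem_Ioi.mp hs))]
      have hgt' : g t = α t := by simp only [hg, if_neg (not_le.mpr hgt)]
      rw [hgt']
      exact (hα t ⟨by linarith, ht.2⟩).congr_of_eventuallyEq hev

/-! ### Global existence under confinement -/

/-- **Global forward existence under confinement** (the continuation principle behind
Proposition 1.6 and the barrier arguments): let `F` be `C¹` at the points of `U`, `K ⊆ U`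
compact, `x₀ ∈ K`. If every solution issued from `x₀` at time `t₀` stays in `K` on `[t₀, T)`
whenever it is defined on `[t₀, T)`, then there is a solution issued from `x₀` at time `t₀`
defined for all `t > t₀ − δ` (some `δ > 0`), in particular for all `t ≥ t₀`.
[cite: BuckmasterCaolaboraGomezserrano2025, Prop. 1.6] -/
theorem exists_forall_hasDerivAt_of_confined [CompleteSpace E] (hF : ∀ x ∈ U, ContDiffAt ℝ 1 F x)
    {K : Set E} (hK : IsCompact K) (hKU : K ⊆ U) {x₀ : E} (hx₀ : x₀ ∈ K) (t₀ : ℝ)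
    (hconf : ∀ (c : ℝ → E) (T : ℝ), c t₀ = x₀ → (∀ t ∈ Ico t₀ T, HasDerivAt c (F (c t)) t) →
      ∀ t ∈ Ico t₀ T, c t ∈ K) :
    ∃ c : ℝ → E, ∃ δ > (0 : ℝ), c t₀ = x₀ ∧ ∀ t, t₀ - δ < t → HasDerivAt c (F (c t)) t := by
  obtain ⟨ε, hε, H⟩ := exists_uniform_time hF hK hKU
  -- the growing intervals
  set Tn : ℕ → ℝ := fun n => t₀ + ((n : ℝ) + 1) * (ε / 2) with hTn
  have hTn_mono : Monotone Tn := fun m n hmn => by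
    simp only [hTn]
    have : (m : ℝ) ≤ n := by exact_mod_cast hmn
    nlinarith
  have hTn0 : ∀ n, t₀ + ε / 2 ≤ Tn n := fun n => by
    simp only [hTn]; nlinarith [(Nat.cast_nonneg n : (0:ℝ) ≤ n)]
  -- one step of the construction
  have key : ∀ (n : ℕ) (c : ℝ → E), c t₀ = x₀ →
      (∀ t ∈ Ioo (t₀ - ε) (Tn n), HasDerivAt c (F (c t)) t) →
      ∃ c' : ℝ → E, EqOn c' c (Ioo (t₀ - ε) (Tn n)) ∧ c' t₀ = x₀ ∧
        ∀ t ∈ Ioo (t₀ - ε) (Tn (n + 1)), HasDerivAt c' (F (c' t)) t := by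
    intro n c hc0 hc
    have hKc : ∀ t ∈ Ico t₀ (Tn n), c t ∈ K :=
      hconf c (Tn n) hc0 fun t ht => hc t ⟨by linarith [ht.1], ht.2⟩
    have ht₁ : Tn n - ε / 4 ∈ Ioo t₀ (Tn n) := ⟨by linarith [hTn0 n], by linarith⟩
    obtain ⟨c', hc'eq, hc'⟩ := exists_extend (K := K) (ε := ε) H (a := t₀ - ε) (a' := t₀)
      (by linarith) ht₁ (by linarith) hc
      (fun t ht => hF _ (hKU (hKc t ⟨ht.1.le, ht.2⟩))) (hKc _ ⟨ht₁.1.le, ht₁.2⟩)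
    refine ⟨c', hc'eq, ?_, fun t ht => hc' t ⟨ht.1, ?_⟩⟩
    · rw [hc'eq ⟨by linarith, by linarith [hTn0 n]⟩, hc0]
    · have : Tn (n + 1) = Tn n + ε / 2 := by simp only [hTn]; push_cast; ring
      linarith [ht.2]
  choose! next hnext_eq hnext0 hnext using key
  -- the initial solution
  obtain ⟨α₀, hα₀0, hα₀⟩ := H x₀ hx₀ t₀
  have hT0 : Tn 0 = t₀ + ε / 2 := by simp only [hTn]; push_cast; ring
  have hα₀' : ∀ t ∈ Ioo (t₀ - ε) (Tn 0), HasDerivAt α₀ (F (α₀ t)) t := fun t ht =>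
    hα₀ t ⟨ht.1, by rw [hT0] at ht; linarith [ht.2]⟩
  -- the sequence of extensions
  let seq : ℕ → ℝ → E := fun n => Nat.rec α₀ (fun k ck => next k ck) n
  have hseq_succ : ∀ n, seq (n + 1) = next n (seq n) := fun n => rfl
  have hseq : ∀ n, seq n t₀ = x₀ ∧ ∀ t ∈ Ioo (t₀ - ε) (Tn n), HasDerivAt (seq n) (F (seq n t)) t := by
    intro n
    induction n with
    | zero => exact ⟨hα₀0, hα₀'⟩
    | succ n ih =>
      rw [hseq_succ]
      exact ⟨hnext0 n (seq n) ih.1 ih.2, hnext n (seq n) ih.1 ih.2⟩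
  have hseq_eq : ∀ m n, m ≤ n → EqOn (seq n) (seq m) (Ioo (t₀ - ε) (Tn m)) := by
    intro m n hmn
    induction n with
    | zero =>
      obtain rfl : m = 0 := Nat.le_zero.mp hmn
      exact fun _ _ => rfl
    | succ n ih =>
      rcases Nat.lt_or_eq_of_le hmn with h | rfl
      · have h1 := ih (Nat.lt_succ_iff.mp h)
        have h2 : EqOn (seq (n + 1)) (seq n) (Ioo (t₀ - ε) (Tn n)) := by
          rw [hseq_succ]
          exact hnext_eq n (seq n) (hseq n).1 (hseq n).2
        intro t ht
        rw [h2 ⟨ht.1, lt_of_lt_of_le ht.2 (hTn_mono (Nat.lt_succ_iff.mp h))⟩, h1 ht]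
      · exact fun _ _ => rfl
  -- the global solution
  set N : ℝ → ℕ := fun t => ⌈(t - t₀) / (ε / 2)⌉₊ with hN
  have hNt : ∀ t, t < Tn (N t) := by
    intro t
    have h1 : (t - t₀) / (ε / 2) ≤ (N t : ℝ) := Nat.le_ceil _
    rw [div_le_iff₀ (by positivity)] at h1
    simp only [hTn]
    nlinarith
  set c : ℝ → E := fun t => seq (N t) t with hc
  have hcm : ∀ m, EqOn c (seq m) (Ioo (t₀ - ε) (Tn m)) := by
    intro m t ht
    simp only [hc]
    rcases le_or_gt (N t) m with h | h
    · exact (hseq_eq (N t) m h ⟨ht.1, hNt t⟩).symm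
    · exact hseq_eq m (N t) h.le ht
  refine ⟨c, ε, hε, ?_, fun t ht => ?_⟩
  · have := hcm 0 (x := t₀) ⟨by linarith, by linarith [hTn0 0]⟩
    rw [this, (hseq 0).1]
  · have htm : t ∈ Ioo (t₀ - ε) (Tn (N t)) := ⟨ht, hNt t⟩
    have hev : c =ᶠ[𝓝 t] seq (N t) := by
      filter_upwards [isOpen_Ioo.mem_nhds htm] with s hs
      exact hcm (N t) hs
    have hd := (hseq (N t)).2 t htm
    rw [show F (c t) = F (seq (N t) t) from rfl]
    exact hd.congr_of_eventuallyEq hev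

end ODE

end BuckmasterCaolaboraGomezserrano2025

end Literature.Analysis.FluidPDE
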